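import Mathlib
import HarnessLib
import Summits.HodgeConjecture.HodgeConjecture.Theorems.HodgeLocusCensusExSet103Certs

/-!
# HodgeLocusCensusFermat3MatchCerts — the census cubic cells AT THE FERMAT CUBIC with RATIONAL plane pairs (part 1: certificate polynomials)

certified instances and evidence bearing on the general Hodge conjecture; no claim.

SETTING (record `run/shared/lean/pub/pub-hlocus/pub-hlocus-ivhs-2/gen26/fermatmatch/FERMAT-MATCH-g26.md`).  On the Fermat cubic X_F = V(Σ_{i<2k} x_i³) ⊂ ℙ^(2k−1) every perfect matching M of
{0,…,2k−1} gives a (k−1)-plane P_M = V(x_a + x_b : {a,b} ∈ M) ⊂ X_F defined over ℚ; two matchings give a pair (P, P′) with dim P ∩ P′ = m = #common edges +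
#cycles of M ∪ M′ − 1, i.e. a point (X_F; P, P′) of the incidence family of the census cell (2k−2, 3, m) with EVERYTHING RATIONAL (no roots of unity).  In
coordinates y adapted to the pair (P = V(y₀..y_{k−1}), P′ = V(y₀..y_{s−1}, y_k..y_{2k−s−1}), integer matrix D·L⁻¹ recorded in the companion file) the two
programs of the (10,3,m) anchor `HodgeLocusCensusExSet103Char0` run UNCHANGED and EXACTLY over ℚ[λ] on the pencil [P] + λ[P′]: implementation A
(`gen25/engine/exsetQg.py`, md5 857d8200…) then implementation B (`gen25/engineB/exsetBg.py`, md5 95ad39d7…) re-run on A's certified basis with cross-checks,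
then `canon_diff` — runs: local run gen26/fermatmatch/local3/ of runmatch.py (chain A exact → B exact on A's certificate → canon_diff), 2026-08-22, log runmatch_local3.log; the same chains also ran as kit j160100.  This file records, for the candidates whose exact runs DECIDE the exceptional set and the generic slice-fibre length
(the pairs listed below; see the record for the undecided ones and for WHY the excess at X_F depends on the pair and not only on the cell), the certificate
polynomials g₁, g₂ of both implementations as printed (recorded program output), their closed forms and complex zero sets (kernel-checked), and that the two
implementations' zero sets agree.  CANDIDATES: M6_3_m1_01234567x02134657 = cell (6,3,1), matchings 01.23.45.67 / 02.13.46.57 (tag `631c44`); M6_3_m0_01234567x07123456 = cell (6,3,0), matchings 01.23.45.67 / 07.12.34.56 (tag `630c8`); M8_3_m1_0123456789x0213495678 = cell (8,3,1), matchings 01.23.45.67.89 / 02.13.49.56.78 (tag `831c46`).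
Division of labour as in the (10,3,m) anchor: the Lean kernel checks identities of recorded data; the computations are the programs'.  Nothing here is a
statement about the Hodge conjecture.
-/

namespace Summit.HodgeConjecture.HodgeConjecture.HodgeLocus.Census.Fermat3Match

open Summit.HodgeConjecture.HodgeConjecture.HodgeLocus.Census.ExSet103Char0 (evalCoeffs)

/-! ## M6_3_m1_01234567x02134657 — cell (6,3,1), P = P_{01.23.45.67}, P′ = P_{02.13.46.57} (run: local3) -/

/-- g₁ of implementation A at M6_3_m1_01234567x02134657 (log `exact_M6_3_m1_01234567x02134657_A.log`, md5 7a6e6f6581a3ca9af7397dc6b7d124cc; certificate `exsetQg_M6_3_m1_01234567x02134657_cert.json`, md5 2e855673b4414577a701fb35d4d39fa1): gcd of the 256 non-zero among 784 computed 6×6 minors of B(λ), low degree first.  Recorded program output. -/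
def g1A_631c44 : List ℤ :=
  [0, 0, 1]

/-- `g1A_631c44` is the coefficient list of (1)·λ^2. -/
theorem eval_g1A_631c44 (z : ℂ) : evalCoeffs g1A_631c44 z = (1:ℂ) * z ^ 2 := by
  simp [evalCoeffs, g1A_631c44, List.zipIdx]

/-- g₂ of implementation A at M6_3_m1_01234567x02134657: gcd of the 16 non-zero among the 84 computed maximal (size-8) minors of N(λ) = [B(λ) | sym q(λ)] (q through A's minimal kernel basis; largest minor degree 8), low degree first.  Recorded program output. -/
def g2A_631c44 : List ℤ :=
  [0, 0, 0, 0, 1, 2, 1]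

/-- `g2A_631c44` is the coefficient list of (1)·λ^4·(λ − (-1))^2. -/
theorem eval_g2A_631c44 (z : ℂ) : evalCoeffs g2A_631c44 z = (1:ℂ) * z ^ 4 * (z - (-1:ℂ)) ^ 2 := by
  simp [evalCoeffs, g2A_631c44, List.zipIdx]; ring

/-- g₁ of implementation B at M6_3_m1_01234567x02134657 (log `exact_M6_3_m1_01234567x02134657_B.log`, md5 47407a6c7b7d302a05645ec6714b0e92; certificate `exsetBg_M6_3_m1_01234567x02134657_cert.json`, md5 bbdc79d09c20c2d1430d0798feecb0c0): gcd of 5 distinct pivot-structure 6×6 minors of B(λ) (Dixon lifting + interpolation), low degree first.  Recorded program output. -/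
def g1B_631c44 : List ℤ :=
  [0, 0, 1]

/-- `g1B_631c44` is the coefficient list of (1)·λ^2. -/
theorem eval_g1B_631c44 (z : ℂ) : evalCoeffs g1B_631c44 z = (1:ℂ) * z ^ 2 := by
  simp [evalCoeffs, g1B_631c44, List.zipIdx]

/-- g₂ of implementation B at M6_3_m1_01234567x02134657: gcd of 3 of B's own pivot-structure minors of N(λ) (size 8), low degree first.  Recorded program output. -/
def g2B_631c44 : List ℤ :=
  [0, 0, 0, 0, 0, 0, 0, 0, 0, 0, 0, 0, 1, 2, 1]

/-- `g2B_631c44` is the coefficient list of (1)·λ^12·(λ − (-1))^2. -/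
theorem eval_g2B_631c44 (z : ℂ) : evalCoeffs g2B_631c44 z = (1:ℂ) * z ^ 12 * (z - (-1:ℂ)) ^ 2 := by
  simp [evalCoeffs, g2B_631c44, List.zipIdx]; ring

/-- CHARACTERISTIC-0 STATEMENT (631c44, implementation A): the complex zero set of g₁·g₂ — the finite λ (engine normalisation = geometric, s₁ = +1) at which the
tangent rank of V_λ at X can drop below c — is exactly {-1, 0}. -/
theorem certificate_zero_set_631c44A : {z : ℂ | evalCoeffs g1A_631c44 z * evalCoeffs g2A_631c44 z = 0} = {(-1:ℂ), (0:ℂ)} := by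
  ext z
  simp only [Set.mem_setOf_eq, eval_g1A_631c44, eval_g2A_631c44, Set.mem_insert_iff, Set.mem_singleton_iff]
  constructor
  · intro h
    rcases mul_eq_zero.mp h with h | h
    · rcases mul_eq_zero.mp h with h | h
      · exact absurd h (by norm_num)
      · exact Or.inr ((pow_eq_zero_iff (by norm_num)).mp h)
    · rcases mul_eq_zero.mp h with h | h
      · rcases mul_eq_zero.mp h with h | h
        · exact absurd h (by norm_num)
        · exact Or.inr ((pow_eq_zero_iff (by norm_num)).mp h)
      · exact Or.inl (sub_eq_zero.mp ((pow_eq_zero_iff (by norm_num)).mp h))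
  · intro h
    rcases h with h | h <;> subst h <;> norm_num

/-- CHARACTERISTIC-0 STATEMENT (631c44, implementation B): the complex zero set of g₁·g₂ — the finite λ (engine normalisation = geometric, s₁ = +1) at which the
tangent rank of V_λ at X can drop below c — is exactly {-1, 0}. -/
theorem certificate_zero_set_631c44B : {z : ℂ | evalCoeffs g1B_631c44 z * evalCoeffs g2B_631c44 z = 0} = {(-1:ℂ), (0:ℂ)} := by
  ext z
  simp only [Set.mem_setOf_eq, eval_g1B_631c44, eval_g2B_631c44, Set.mem_insert_iff, Set.mem_singleton_iff]
  constructor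
  · intro h
    rcases mul_eq_zero.mp h with h | h
    · rcases mul_eq_zero.mp h with h | h
      · exact absurd h (by norm_num)
      · exact Or.inr ((pow_eq_zero_iff (by norm_num)).mp h)
    · rcases mul_eq_zero.mp h with h | h
      · rcases mul_eq_zero.mp h with h | h
        · exact absurd h (by norm_num)
        · exact Or.inr ((pow_eq_zero_iff (by norm_num)).mp h)
      · exact Or.inl (sub_eq_zero.mp ((pow_eq_zero_iff (by norm_num)).mp h))
  · intro h
    rcases h with h | h <;> subst h <;> norm_num

/-- The two implementations' certificate zero sets at M6_3_m1_01234567x02134657 coincide (both are {-1, 0} = E(X_F; P, P′) ∩ ℂ of the records in the companion file). -/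
theorem certificate_zero_sets_agree_631c44 :
    {z : ℂ | evalCoeffs g1A_631c44 z * evalCoeffs g2A_631c44 z = 0} = {z : ℂ | evalCoeffs g1B_631c44 z * evalCoeffs g2B_631c44 z = 0} := by
  rw [certificate_zero_set_631c44A, certificate_zero_set_631c44B]

/-! ## M6_3_m0_01234567x07123456 — cell (6,3,0), P = P_{01.23.45.67}, P′ = P_{07.12.34.56} (run: local3) -/

/-- g₁ of implementation A at M6_3_m0_01234567x07123456 (log `exact_M6_3_m0_01234567x07123456_A.log`, md5 9e494bb70a3d81d2276e32909ba2adeb; certificate `exsetQg_M6_3_m0_01234567x07123456_cert.json`, md5 e992810ab1dae494a14bd5f736490711): gcd of the 64 non-zero among 64 computed 7×7 minors of B(λ), low degree first.  Recorded program output. -/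
def g1A_630c8 : List ℤ :=
  [0, 0, 0, 1]

/-- `g1A_630c8` is the coefficient list of (1)·λ^3. -/
theorem eval_g1A_630c8 (z : ℂ) : evalCoeffs g1A_630c8 z = (1:ℂ) * z ^ 3 := by
  simp [evalCoeffs, g1A_630c8, List.zipIdx]

/-- g₂ of implementation A at M6_3_m0_01234567x07123456: gcd of the 8 non-zero among the 8 computed maximal (size-8) minors of N(λ) = [B(λ) | sym q(λ)] (q through A's minimal kernel basis; largest minor degree 6), low degree first.  Recorded program output. -/
def g2A_630c8 : List ℤ :=
  [0, 0, 0, 0, -1, 1]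

/-- `g2A_630c8` is the coefficient list of (1)·λ^4·(λ − (1))^1. -/
theorem eval_g2A_630c8 (z : ℂ) : evalCoeffs g2A_630c8 z = (1:ℂ) * z ^ 4 * (z - (1:ℂ)) ^ 1 := by
  simp [evalCoeffs, g2A_630c8, List.zipIdx]; ring

/-- g₁ of implementation B at M6_3_m0_01234567x07123456 (log `exact_M6_3_m0_01234567x07123456_B.log`, md5 c42cc8c31eec49461194d66cac7e6515; certificate `exsetBg_M6_3_m0_01234567x07123456_cert.json`, md5 56a1d5ec842f34f4fc19c07a03f1a090): gcd of 5 distinct pivot-structure 7×7 minors of B(λ) (Dixon lifting + interpolation), low degree first.  Recorded program output. -/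
def g1B_630c8 : List ℤ :=
  [0, 0, 0, 1]

/-- `g1B_630c8` is the coefficient list of (1)·λ^3. -/
theorem eval_g1B_630c8 (z : ℂ) : evalCoeffs g1B_630c8 z = (1:ℂ) * z ^ 3 := by
  simp [evalCoeffs, g1B_630c8, List.zipIdx]

/-- g₂ of implementation B at M6_3_m0_01234567x07123456: gcd of 4 of B's own pivot-structure minors of N(λ) (size 8), low degree first.  Recorded program output. -/
def g2B_630c8 : List ℤ :=
  [0, 0, 0, 0, 0, 0, 0, 0, 0, 0, -1, 1]

/-- `g2B_630c8` is the coefficient list of (1)·λ^10·(λ − (1))^1. -/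
theorem eval_g2B_630c8 (z : ℂ) : evalCoeffs g2B_630c8 z = (1:ℂ) * z ^ 10 * (z - (1:ℂ)) ^ 1 := by
  simp [evalCoeffs, g2B_630c8, List.zipIdx]; ring

/-- CHARACTERISTIC-0 STATEMENT (630c8, implementation A): the complex zero set of g₁·g₂ — the finite λ (engine normalisation = geometric, s₁ = +1) at which the
tangent rank of V_λ at X can drop below c — is exactly {0, 1}. -/
theorem certificate_zero_set_630c8A : {z : ℂ | evalCoeffs g1A_630c8 z * evalCoeffs g2A_630c8 z = 0} = {(0:ℂ), (1:ℂ)} := by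
  ext z
  simp only [Set.mem_setOf_eq, eval_g1A_630c8, eval_g2A_630c8, Set.mem_insert_iff, Set.mem_singleton_iff]
  constructor
  · intro h
    rcases mul_eq_zero.mp h with h | h
    · rcases mul_eq_zero.mp h with h | h
      · exact absurd h (by norm_num)
      · exact Or.inl ((pow_eq_zero_iff (by norm_num)).mp h)
    · rcases mul_eq_zero.mp h with h | h
      · rcases mul_eq_zero.mp h with h | h
        · exact absurd h (by norm_num)
        · exact Or.inl ((pow_eq_zero_iff (by norm_num)).mp h)
      · exact Or.inr (sub_eq_zero.mp ((pow_eq_zero_iff (by norm_num)).mp h))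
  · intro h
    rcases h with h | h <;> subst h <;> norm_num

/-- CHARACTERISTIC-0 STATEMENT (630c8, implementation B): the complex zero set of g₁·g₂ — the finite λ (engine normalisation = geometric, s₁ = +1) at which the
tangent rank of V_λ at X can drop below c — is exactly {0, 1}. -/
theorem certificate_zero_set_630c8B : {z : ℂ | evalCoeffs g1B_630c8 z * evalCoeffs g2B_630c8 z = 0} = {(0:ℂ), (1:ℂ)} := by
  ext z
  simp only [Set.mem_setOf_eq, eval_g1B_630c8, eval_g2B_630c8, Set.mem_insert_iff, Set.mem_singleton_iff]
  constructor
  · intro h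
    rcases mul_eq_zero.mp h with h | h
    · rcases mul_eq_zero.mp h with h | h
      · exact absurd h (by norm_num)
      · exact Or.inl ((pow_eq_zero_iff (by norm_num)).mp h)
    · rcases mul_eq_zero.mp h with h | h
      · rcases mul_eq_zero.mp h with h | h
        · exact absurd h (by norm_num)
        · exact Or.inl ((pow_eq_zero_iff (by norm_num)).mp h)
      · exact Or.inr (sub_eq_zero.mp ((pow_eq_zero_iff (by norm_num)).mp h))
  · intro h
    rcases h with h | h <;> subst h <;> norm_num

/-- The two implementations' certificate zero sets at M6_3_m0_01234567x07123456 coincide (both are {0, 1} = E(X_F; P, P′) ∩ ℂ of the records in the companion file). -/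
theorem certificate_zero_sets_agree_630c8 :
    {z : ℂ | evalCoeffs g1A_630c8 z * evalCoeffs g2A_630c8 z = 0} = {z : ℂ | evalCoeffs g1B_630c8 z * evalCoeffs g2B_630c8 z = 0} := by
  rw [certificate_zero_set_630c8A, certificate_zero_set_630c8B]

/-! ## M8_3_m1_0123456789x0213495678 — cell (8,3,1), P = P_{01.23.45.67.89}, P′ = P_{02.13.49.56.78} (run: local3) -/

/-- g₁ of implementation A at M8_3_m1_0123456789x0213495678 (log `exact_M8_3_m1_0123456789x0213495678_A.log`, md5 db73b486b3a4d7a5e174ac472fb43ace; certificate `exsetQg_M8_3_m1_0123456789x0213495678_cert.json`, md5 7ee464de035d3b8b1eaeb6f7a7628171): gcd of the 4 non-zero among 241 computed 19×19 minors of B(λ), low degree first.  Recorded program output. -/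
def g1A_831c46 : List ℤ :=
  [0, 0, 0, 0, 0, 0, 0, 0, 0, 1]

/-- `g1A_831c46` is the coefficient list of (1)·λ^9. -/
theorem eval_g1A_831c46 (z : ℂ) : evalCoeffs g1A_831c46 z = (1:ℂ) * z ^ 9 := by
  simp [evalCoeffs, g1A_831c46, List.zipIdx]

/-- g₂ of implementation A at M8_3_m1_0123456789x0213495678: gcd of the 4 non-zero among the 161 computed maximal (size-20) minors of N(λ) = [B(λ) | sym q(λ)] (q through A's minimal kernel basis; largest minor degree 12), low degree first.  Recorded program output. -/
def g2A_831c46 : List ℤ :=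
  [0, 0, 0, 0, 0, 0, 0, 0, 0, 0, -1, 1]

/-- `g2A_831c46` is the coefficient list of (1)·λ^10·(λ − (1))^1. -/
theorem eval_g2A_831c46 (z : ℂ) : evalCoeffs g2A_831c46 z = (1:ℂ) * z ^ 10 * (z - (1:ℂ)) ^ 1 := by
  simp [evalCoeffs, g2A_831c46, List.zipIdx]; ring

/-- g₁ of implementation B at M8_3_m1_0123456789x0213495678 (log `exact_M8_3_m1_0123456789x0213495678_B.log`, md5 027088e98fdac92388e150064b5f4d5d; certificate `exsetBg_M8_3_m1_0123456789x0213495678_cert.json`, md5 ccb5eff8bf90be3ae9ec2f1a476fca55): gcd of 5 distinct pivot-structure 19×19 minors of B(λ) (Dixon lifting + interpolation), low degree first.  Recorded program output. -/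
def g1B_831c46 : List ℤ :=
  [0, 0, 0, 0, 0, 0, 0, 0, 0, 1]

/-- `g1B_831c46` is the coefficient list of (1)·λ^9. -/
theorem eval_g1B_831c46 (z : ℂ) : evalCoeffs g1B_831c46 z = (1:ℂ) * z ^ 9 := by
  simp [evalCoeffs, g1B_831c46, List.zipIdx]

/-- g₂ of implementation B at M8_3_m1_0123456789x0213495678: gcd of 5 of B's own pivot-structure minors of N(λ) (size 20), low degree first.  Recorded program output. -/
def g2B_831c46 : List ℤ :=
  [0, 0, 0, 0, 0, 0, 0, 0, 0, 0, 0, 0, 0, 0, 0, 0, 0, 0, 0, 0, 0, 0, 0, 0, 0, 0, 0, 0, -1, 1]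

/-- `g2B_831c46` is the coefficient list of (1)·λ^28·(λ − (1))^1. -/
theorem eval_g2B_831c46 (z : ℂ) : evalCoeffs g2B_831c46 z = (1:ℂ) * z ^ 28 * (z - (1:ℂ)) ^ 1 := by
  simp [evalCoeffs, g2B_831c46, List.zipIdx]; ring

/-- CHARACTERISTIC-0 STATEMENT (831c46, implementation A): the complex zero set of g₁·g₂ — the finite λ (engine normalisation = geometric, s₁ = +1) at which the
tangent rank of V_λ at X can drop below c — is exactly {0, 1}. -/
theorem certificate_zero_set_831c46A : {z : ℂ | evalCoeffs g1A_831c46 z * evalCoeffs g2A_831c46 z = 0} = {(0:ℂ), (1:ℂ)} := by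
  ext z
  simp only [Set.mem_setOf_eq, eval_g1A_831c46, eval_g2A_831c46, Set.mem_insert_iff, Set.mem_singleton_iff]
  constructor
  · intro h
    rcases mul_eq_zero.mp h with h | h
    · rcases mul_eq_zero.mp h with h | h
      · exact absurd h (by norm_num)
      · exact Or.inl ((pow_eq_zero_iff (by norm_num)).mp h)
    · rcases mul_eq_zero.mp h with h | h
      · rcases mul_eq_zero.mp h with h | h
        · exact absurd h (by norm_num)
        · exact Or.inl ((pow_eq_zero_iff (by norm_num)).mp h)
      · exact Or.inr (sub_eq_zero.mp ((pow_eq_zero_iff (by norm_num)).mp h))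
  · intro h
    rcases h with h | h <;> subst h <;> norm_num

/-- CHARACTERISTIC-0 STATEMENT (831c46, implementation B): the complex zero set of g₁·g₂ — the finite λ (engine normalisation = geometric, s₁ = +1) at which the
tangent rank of V_λ at X can drop below c — is exactly {0, 1}. -/
theorem certificate_zero_set_831c46B : {z : ℂ | evalCoeffs g1B_831c46 z * evalCoeffs g2B_831c46 z = 0} = {(0:ℂ), (1:ℂ)} := by
  ext z
  simp only [Set.mem_setOf_eq, eval_g1B_831c46, eval_g2B_831c46, Set.mem_insert_iff, Set.mem_singleton_iff]
  constructor
  · intro h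
    rcases mul_eq_zero.mp h with h | h
    · rcases mul_eq_zero.mp h with h | h
      · exact absurd h (by norm_num)
      · exact Or.inl ((pow_eq_zero_iff (by norm_num)).mp h)
    · rcases mul_eq_zero.mp h with h | h
      · rcases mul_eq_zero.mp h with h | h
        · exact absurd h (by norm_num)
        · exact Or.inl ((pow_eq_zero_iff (by norm_num)).mp h)
      · exact Or.inr (sub_eq_zero.mp ((pow_eq_zero_iff (by norm_num)).mp h))
  · intro h
    rcases h with h | h <;> subst h <;> norm_num

/-- The two implementations' certificate zero sets at M8_3_m1_0123456789x0213495678 coincide (both are {0, 1} = E(X_F; P, P′) ∩ ℂ of the records in the companion file). -/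
theorem certificate_zero_sets_agree_831c46 :
    {z : ℂ | evalCoeffs g1A_831c46 z * evalCoeffs g2A_831c46 z = 0} = {z : ℂ | evalCoeffs g1B_831c46 z * evalCoeffs g2B_831c46 z = 0} := by
  rw [certificate_zero_set_831c46A, certificate_zero_set_831c46B]

end Summit.HodgeConjecture.HodgeConjecture.HodgeLocus.Census.Fermat3Match
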